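import Summits.QuantumFields.YangMills.Theorems.BalabanUVNodesN16Stub1ShareK3AxV8
import Summits.QuantumFields.YangMills.Theorems.BalabanUVNodesN16H7OfN07RecordSlotKey

/-!
# Route «BalabanUVNodes», crux K3ᴬ `SpineGivenEndpointR13SepCoPHVAx` (stmt-QuantumFields-27247), node N16 = NE3 — NODE N16's K3ᴬ v8 SENTENCE `WitnessDialN16Free N β` AND ITS
# THREE CONSUMER FACES **FROM THE TWO NEIGHBOUR NODES' OBJECTS OF RECORD, BY NAME**: node N05's Σ-object (p681888's conclusion text at `stage3OfFamilyMat F N`) and node N07's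
# K1-SIDE SLOT OF RECORD `B11Leaf (Z11OfRecord F N ζ)` ([Balaban1985Variational] Theorem 1 AT NODE 00's (0.4)-objects), through dag-n16-w1's ONE located (0.4) → (42) transfer
# `Thm1AtTransfer04toSlot F N ζ B₀` — the v8-currency edition of module 48 (`…N16PinnedLooseMatchOfN07SlotKey`, K3⁷ v5 currency)

Cell `pub-ymgap`, seat `pub-ymgap-dag-n16-e` (R134 acceleration seat (a), strategy s2 = BY-NAME KNIT at the record; HUMAN RULING D-0062; chair R424 venue), generation 32,
module 67 (THEOREMS ONLY, 0 `def`, 0 `sorry`, standard axioms; Theses-free).  `--kind proof --supports stmt-QuantumFields-27247 --as helper` (count-neutral; proves NO registered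
stub — every theorem below has hypotheses).  `bears_on: R4∕N16 · edges N05 → N16, N07 → N16 (N07 at its RECORD SLOT) · out-edges N16 → N19′ ∕ N21 (§2's per-family face)`.
Over module 65 `…N16Stub1ShareK3AxV8` (✓p812347: the stub-1 bill `stub1Text_of_witnessFree`), module 63 `…N16WitnessDialFaceCmap` (✓p811120: `WitnessDialN16Free`, the
guard-generic Ax face), module 62 `…N16EntrySqueezeJunctionReadingFree` (✓p811089: the reading-free producer), dag-n16-w1's files 3 ∕ 10 `…N16H7OfN07RecordSlot[Key]`
(✓p588364 ∕ ✓p613213: `lipGauge`, `radiiMono_lipGauge'`, `interface_lipGauge'`, `Thm1AtTransfer04toSlot`) and NODE 00's `CarriersZ.exists_thm1At_of_b11Leaf_Z11OfRecord` —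
all CITED BY NAME, none edited.

THE POINT.  After module 65 the registered stub-1 text of K3ᴬ v8 (`K3Skeleton13SepCoPHAxV8.stub_rates13HV`, b38fad1764a2d455) reads of node N16 EXACTLY the reading- and
centre-free tuned-witness sentence `WitnessDialN16Free 2 β` (63 §1); modules 62∕63 inhabit it from `hE` ∕ `hN05` and an ABSTRACT slot key `(G, hGm, hG, C, hR)`.  Node N07's
statement OF RECORD is its K1-side slot `DagBinding.B11Leaf (Node00.Z11OfRecord F N ζ)` — print's Theorem 1 (`B11Thm1CarrierT.Thm1Printed`) at NODE 00's (0.4)-constrained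
variational problems `varProblemT F N i.K i.k (ζ.R i)` over the family index.  Node N16's NE3 objects of record are (42)-constrained (`MinimalActionSandwich.IsMinimiser` over
`B7Prop2Explicit.avgIter`; dag-n16-w3 `…N16AveragingPin`), so the N07 → N16 edge passes through the located AVERAGING TRANSFER, displayed ONCE as dag-n16-w1's
`Thm1AtTransfer04toSlot F N ζ B₀ := (Thm 1 at the (0.4)-objects) → ∃ C', C'.B₃ ≤ B₀ ∧ (T9ˢ)(lipGauge, C') ∧ (T8)(C')` ([Balaban1987RG1] p. 253∕254: «the considerations and
results … are valid universally for all averages satisfying the above properties» — PRINT's CLAIM, proved nowhere in print as such and nowhere in the tree).  §1 reads the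
slot key at `G := lipGauge 4 (Fin N)` off N07's slot and the transfer (`choose`); §2–§4 are modules 62 §3 ∕ 63 §1 ∕ 63 §3 ∕ 65 §4 at that key.  AFTER THIS FILE node N16's
K3ᴬ v8 share displays, besides the other lanes' objects the stub binds, ONLY: `hN05` (node N05's Σ-object — the conclusion of node N05's ✓p681888
`exists_thm4Body_prop3Body_uniformP_of_bindersLettersPer_doorL` at `θ := stage3OfFamilyMat F N`, itself displayed on node N06's per-period binders), `B11Leaf (Z11OfRecord F N ζ)`
(node N07's slot of record) and `Thm1AtTransfer04toSlot F N ζ B₀` (the located transfer) — the DAG's own neighbour statements plus one located dictionary row.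

CONTENTS.  §1 `exists_slotKey_lipGauge_of_b11Leaf_transferSlot` — per family, N07's slot ∧ the transfer ⟹ constants `C : T4Family → B11Thm1.Consts` with (T9ˢ) at `lipGauge`
and (T8).  §2 ★★ `witnessDialN16Free_of_n05UniformP_b11Leaf_transferSlot` (`0 ≤ β ≤ 1`) · `witnessDialN16Free_of_entry_b11Leaf_transferSlot` (`β ≤ 1`, node N16's θ-free
chain-entry object `hE`) · ★ `exists_letters_n16HolderAt_looseLayer_of_n05UniformP_b11Leaf_transferSlot` (62 §3's per-family face — the N19′ ∕ N21 lanes' N16 row: letters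
`ℓ₃ g B` with THE END's rows, the MATCH row and `N16HolderAt (ne3OfRecord₁₁ F ⟨const layer (ℓ₃ F), dom cut (ℓ₃ F).ε ∕ B F⟩) β` for every family).  §3 ★★
`exists_guarded_pin_n16HolderAt_rateCarriersAx_of_n05UniformP_b11Leaf_transferSlot` (63 §3's guard-generic face at the Ax reading).  §4 ★★
`stub1Text_of_n05UniformP_b11Leaf_transferSlot` (`N = 2`): the REGISTERED stub-1 TEXT from β in print's window, ONE v4-guarded reading, the K4 face at its NE3-ERASED reading
(the other lanes'), node N05's Σ-text, node N07's slot of record and the transfer (65 §4 ∘ §2).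

IDENTITY (for the record; nothing new).  Node N16's decl of record is `YMDAG.UVSplit.N16At c` = `NE3EnergyWeightedCovShape.NE3EnergyRateWCov 4 (sfClass 4 c.L c.Nper c.ε) c.L c.Nper
c.b c.g c.C c.Λ₁ c.Λ₂' c.dom` (T-E_w^cov; `N16_NE3.lean`); K3ᴬ v8 reads `N16HolderDefs.N16HolderAt c β` = `CovRootHolder 4 … β c.dom` (`n16HolderAt_iff`), the R-β re-wording of
the (Lip₂′ᶜ) conjunct at a printed Hölder exponent `β < 1` ([Balaban1985RegularSpaces] (1.36) p. 82 «β ≦ β₀ < 1»); `β = 1` IS the decl of record (`n16HolderAt_one_iff`) and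
implies every `β ≤ 1` (`n16HolderAt_of_n16At`).  What §2–§4 inhabit is the `β < 1` form AS CONSUMED, at letters TUNED from the in-edges' constants (∃-dial; the ∀-dial sentence
is void — ✓p776216 `covRootHolder_every_holderConstant_of_forallDial`).

HONEST FRAMING.  Composition BY NAME (`choose` + `exact`); no estimate, no definition.  DISPLAYED, asserted for no family: `hN05` ∕ `hE` (node N05's [Balaban1985RegularSpaces]
Thm 4 ∕ Prop 3 bodies at the κ-periodic torus members — N05∕N06 content), `B11Leaf (Z11OfRecord F N ζ)` (node N07's content; N07 NOT discharged), the transfer (located;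
hides A1 plaquette-only class and D-s3-2 global minimum; at `B₀ < 1`, rank two, its pair with N07's slot is uninhabited — dag-n16-w1 `…N16SlotKeyUnit` §2b — every consumer
keys `B₀` large); in §3∕§4 also the other lanes' reading, guard and erased K4 face.  NO stub of K3ᴬ v8 closed or claimed; N16 ∕ N05 ∕ N06 ∕ N07 NOT discharged by this file;
counts UNMOVED (typed 28∕28 · discharged 8∕27 · A 8∕28).  One finite four-torus at fixed `ε`, Bałaban AS PRINTED — NOT ℝ⁴, NOT infinite volume, NOT OS, NOT a mass gap; the
YM mass gap (Clay) is NOT proved by any of this.  No `sorry` ∕ `instance` ∕ `notation`; standard axioms.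
References: [Balaban1985RegularSpaces] T. Bałaban, CMP **99** (1985) 75–102, Thm 4 p. 88, Prop. 3 p. 87, (1.36) p. 82; [Balaban1985Variational] T. Bałaban, CMP **102** (1985)
277–309, Thm 1 (8)–(10) p. 279; [Balaban1987RG1] T. Bałaban, CMP **109** (1987) 249–301, pp. 253–254.
-/

set_option autoImplicit false

open scoped BigOperators Matrix Matrix.Norms.L2Operator
open NormedSpace

namespace Summit.QuantumFields.YangMills.BalabanUVNodes.N16WitnessDialOfRecordEdges

open Literature.MathematicalPhysics.QuantumFieldTheory.Balaban1983to89
open Literature.MathematicalPhysics.QuantumFieldTheory.Balaban1983to89.T4Continuum (T4Family ULoop)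
open B7Prop1Explicit B7Prop2Explicit MatrixLog UnitaryModel
open T4AveragingDeficitWall hiding Site Plane Plaq Bond
open B7Eq92Concrete (mgauge)
open B8Ineq132 (covDerivFwd)
open B8Eq184Proof (cfgExp)
open B8Eq119TwistedAxial (Restr129)
open B8Eq138LandauZd (covLap IsLandau138)
open B8Thm4TorusAt (torusLam Thm4TorusAt)
open B8LeafModelZdHP2Per (zdGF3HP₂Per)
open Node00 (Stage13Params Stage13HParams IdxB8SubDPerκ NE3Letters₁₁ ne3ConstLayerOfRecord₁₁ ne3NperOfRecord₁₁ ne3DomOfRecord₁₁ MatA ZIdx ResidZ Z11OfRecord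
  exists_thm1At_of_b11Leaf_Z11OfRecord)
open Summit.QuantumFields.BalabanUV.T4Continuum
open MinimalActionSandwich (IsMinimiser)
open MinimalActionRate (sfClass)
open MinimalActionDictionary (torusVP RadiiMono)
open B11 (Regularity)
open B11Thm1 (Thm1At)
open DagBinding (B11Leaf)
open YMDAG.UVSplit (ne3OfRecord₁₁ RateReading₁₃CoPHAx rateCarriersOfRecord₁₃CoPHCmap)
open Summit.QuantumFields.YangMills.BalabanUVNodes.N16HolderDefs (N16HolderAt)
open Summit.QuantumFields.YangMills.BalabanUVNodes.N16PinnedLayer13CoPH (N16LettersEnd N16PinnedLooseAx eraseNE3Ax)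
open Summit.QuantumFields.YangMills.BalabanUVNodes.N16Stage3OfFamilyMat (stage3OfFamilyMat)
open Summit.QuantumFields.YangMills.BalabanUVNodes.N16EntrySqueezeJunctionReadingFree (exists_letters_n16HolderAt_looseLayer_of_n05UniformP_reg910Slot)
open Summit.QuantumFields.YangMills.BalabanUVNodes.N16WitnessDialFaceCmap (WitnessDialN16Free repinAx witnessDialN16Free_of_entry_reg910Slot
  witnessDialN16Free_of_n05UniformP_reg910Slot exists_guarded_pin_n16HolderAt_rateCarriersAx_of_witnessFree)
open Summit.QuantumFields.YangMills.BalabanUVNodes.N16H7OfN07RecordSlot (lipGauge radiiMono_lipGauge' interface_lipGauge')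
open Summit.QuantumFields.YangMills.BalabanUVNodes.N16H7OfN07RecordSlotKey (Thm1AtTransfer04toSlot)
open Summit.QuantumFields.YangMills.BalabanUVNodes.N16Stub1ShareK3AxV8 (stub1Text_of_witnessFree)
open Summit.QuantumFields.YangMills.Theorems.K3AxV8Defs (RateReading13AxP RunSel LetterReading rrOfRecord KeyedRatesHolderD4V GuardedReading GuardedReadingN16)

noncomputable section

variable {N : ℕ} [NeZero N] {β : ℝ}

/-! ## §1 The slot key at `lipGauge` from node N07's slot of record and the located transfer -/

/-- **THE SLOT KEY FOR EVERY FAMILY, FROM NODE N07's SLOT OF RECORD AND THE TRANSFER**: per family, `B11Leaf (Z11OfRecord F N ζ)` ⟹ Theorem 1 at NODE 00's (0.4)-objects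
(`exists_thm1At_of_b11Leaf_Z11OfRecord`) ⟹ (the transfer) constants with (T9ˢ) — r2's `B11.Regularity` ((9)–(10) in some gauge) on the collar-slot cube about every site, for
every (8)-class minimiser of leaf-06's `torusVP` at `lipGauge`, every `ε₁`-datum — and (T8) — such minimisers exist; `choose` over the families gives `C : T4Family →
B11Thm1.Consts`.  Both hypotheses displayed; nothing of Bałaban asserted. [cite: Balaban1985Variational, Thm 1 (8)–(10) p.279] [folklore] -/
theorem exists_slotKey_lipGauge_of_b11Leaf_transferSlot
    (h07 : ∀ F : T4Family, ∃ (ζ : ResidZ F N) (B₀ : ℝ), B11Leaf (Z11OfRecord F N ζ) ∧ Thm1AtTransfer04toSlot F N ζ B₀) :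
    ∃ C : T4Family → B11Thm1.Consts,
      (∀ (F : T4Family) (k : ℕ) (ε₁ : ℝ), 0 < ε₁ → ε₁ ≤ (C F).a₁ → ∀ (V U : Site 4 → Fin 4 → (MatA N)ˣ), V ∈ sfClass 4 F.L (ne3NperOfRecord₁₁ F 0 0) ε₁ 0 →
        IsMinimiser 4 (sfClass 4 F.L (ne3NperOfRecord₁₁ F 0 0) ((C F).B₃ * ε₁)) F.L (ne3NperOfRecord₁₁ F 0 0) (k + 1) V U →
          ∀ x : Site 4, Regularity (torusVP 4 F.L (ne3NperOfRecord₁₁ F 0 0) (lipGauge 4 (Fin N)) (k + 1)) (C F).B₃ (C F).B₄ ε₁ U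
            (x, F.L ^ (k + 1) - 1 + F.L ^ (k + 1) + 2)) ∧
      (∀ (F : T4Family) (k : ℕ) (ε₁ : ℝ), 0 < ε₁ → ε₁ ≤ (C F).a₁ → ∀ V : Site 4 → Fin 4 → (MatA N)ˣ, V ∈ sfClass 4 F.L (ne3NperOfRecord₁₁ F 0 0) ε₁ 0 →
        ∃ U : Site 4 → Fin 4 → (MatA N)ˣ, IsMinimiser 4 (sfClass 4 F.L (ne3NperOfRecord₁₁ F 0 0) ((C F).B₃ * ε₁)) F.L (ne3NperOfRecord₁₁ F 0 0) (k + 1) V U) := by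
  choose ζ B₀ h07' hT using h07
  choose C' hC' using fun F => hT F (exists_thm1At_of_b11Leaf_Z11OfRecord (h07' F))
  exact ⟨C', fun F => (hC' F).2.1, fun F => (hC' F).2.2⟩

/-! ## §2 ★★ Node N16's reading-free tuned-witness sentence from the neighbour nodes' objects of record -/

/-- **★★ `WitnessDialN16Free N β` FROM NODE N05's Σ-OBJECT, NODE N07's SLOT OF RECORD AND THE TRANSFER** (`0 ≤ β ≤ 1`): module 63 §1's `witnessDialN16Free_of_n05UniformP_reg910Slot`
at `G := lipGauge 4 (Fin N)` (`radiiMono_lipGauge'`, `interface_lipGauge'`) with §1's constants and (T9ˢ) as its `hR`.  `hN05` = node N05's ✓p681888 conclusion text at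
`θ := stage3OfFamilyMat F N`; `h07` = node N07's slot of record ∧ the located transfer, per family.
[cite: Balaban1985RegularSpaces, Thm 4 p.88, Prop. 3 p.87] [cite: Balaban1985Variational, Thm 1 (8)–(10) p.279] [folklore] -/
theorem witnessDialN16Free_of_n05UniformP_b11Leaf_transferSlot (hβ0 : 0 ≤ β) (hβ1 : β ≤ 1)
    (hN05 : ∀ F : T4Family, letI : CStarAlgebra (Matrix (Fin N) (Fin N) ℂ) := B10Eq29TubeLine.cstarAlgebraMatrix N
      ∃ (Mκ Rκ : ℕ) (len : Site 4 → ℝ), (∀ v : Site 4, 0 < len v → 1 ≤ len v) ∧ (∀ μ : Fin 4, len (e μ) = 1) ∧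
      ∃ (inp : B8.B9Inputs) (B₀β B₈ c₄ c₃ : ℝ), inp.B₀ ≤ B₈ ∧ 0 < c₄ ∧ 0 < c₃ ∧
        ∀ (ν : {k : ℕ // 1 ≤ k}) (a : IdxB8SubDPerκ (stage3OfFamilyMat F N) (ne3NperOfRecord₁₁ F 0 0 * F.L ^ ν.1) Mκ Rκ),
          B8.Thm4Body c₄ (5 * ((4 : ℕ) : ℝ) * F.L * B₈)
            (fun _ : Unit => (zdGF3HP₂Per (Matrix (Fin N) (Fin N) ℂ) F.L β len a.toZdIdx (ne3NperOfRecord₁₁ F 0 0 * F.L ^ ν.1)).toGFData) ∧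
          B8.Prop3Body c₃ 4 (F.L : ℝ) (2097152 * (((4 : ℕ) : ℝ) + 1) ^ 2 * (F.L : ℝ) ^ 2) inp B₀β
            (fun _ : Unit => (zdGF3HP₂Per (Matrix (Fin N) (Fin N) ℂ) F.L β len a.toZdIdx (ne3NperOfRecord₁₁ F 0 0 * F.L ^ ν.1)).toGFData2))
    (h07 : ∀ F : T4Family, ∃ (ζ : ResidZ F N) (B₀ : ℝ), B11Leaf (Z11OfRecord F N ζ) ∧ Thm1AtTransfer04toSlot F N ζ B₀) :
    WitnessDialN16Free N β := by
  obtain ⟨C, hR, -⟩ := exists_slotKey_lipGauge_of_b11Leaf_transferSlot h07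
  exact witnessDialN16Free_of_n05UniformP_reg910Slot hβ0 hβ1 hN05 (G := fun _ => lipGauge 4 (Fin N)) (fun _ => radiiMono_lipGauge')
    (fun _ U x K α₀ α₁ α₂ hK hGU => interface_lipGauge' U x K α₀ α₁ α₂ hK hGU) C hR

/-- **★★ THE SAME FROM NODE N16's θ-FREE CHAIN-ENTRY OBJECT `hE`** (`β ≤ 1`; module 63 §1's `witnessDialN16Free_of_entry_reg910Slot` at the record-slot key — `hE` is served by
node N05's Σ-object through module 58's bridge `exists_entry_of_n05UniformP`, or by the ℤᵈ road). [cite: Balaban1985Variational, Thm 1 (8)–(10) p.279] [folklore] -/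
theorem witnessDialN16Free_of_entry_b11Leaf_transferSlot (hβ1 : β ≤ 1)
    (hE : ∀ F : T4Family, ∃ B Bh c₁' : ℝ, 0 < B ∧ 0 < c₁' ∧ 16 * (B * c₁') ≤ 1 ∧
      ∀ k, 1 ≤ k → Thm4TorusAt F.L k (((ne3NperOfRecord₁₁ F 0 0 * F.L ^ k : ℕ) : ℤ)) (((F.L : ℝ) ^ k)⁻¹) c₁' (unitaryUnits (Matrix (Fin N) (Fin N) ℂ))
        (fun _ => True) (Restr129 F.L k (torusLam k))
        (fun (α₀ α₁ : ℝ) (U₀ U' : Site 4 → Fin 4 → (Matrix (Fin N) (Fin N) ℂ)ˣ) (u : Site 4 → (Matrix (Fin N) (Fin N) ℂ)ˣ) =>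
          ∃ A : Site 4 → Fin 4 → Matrix (Fin N) (Fin N) ℂ,
            (∀ x μ, IsSelfAdjoint (A x μ)) ∧ (∀ (x : Site 4) (κ μ : Fin 4), A (x + (((ne3NperOfRecord₁₁ F 0 0 * F.L ^ k : ℕ) : ℤ)) • e κ) μ = A x μ) ∧
            mgauge U₀ u (cfgExp (((F.L : ℝ) ^ k)⁻¹) A) = U' ∧
            (∀ x μ, ‖A x μ‖ ≤ B * (α₀ + α₁)) ∧
            (∀ (μ : Fin 4) (x : Site 4) (κ : Fin 4), ‖covDerivFwd (((F.L : ℝ) ^ k)⁻¹) U₀ μ (fun z => A z κ) x‖ ≤ B * (α₀ + α₁)) ∧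
            IsLandau138 F.L k (((F.L : ℝ) ^ k)⁻¹) Set.univ (torusLam k) U₀ A ∧
            (∀ (μ : Fin 4) (y : Site 4) (κ : Fin 4),
              ‖Ad (U₀ y μ) (covDerivFwd (((F.L : ℝ) ^ k)⁻¹) U₀ μ (fun z => A z κ) (y + e μ)) - covDerivFwd (((F.L : ℝ) ^ k)⁻¹) U₀ μ (fun z => A z κ) y‖
                ≤ Bh * (α₀ + α₁) * (((F.L : ℝ)⁻¹) ^ k) ^ β) ∧
            (∀ (x : Site 4) (κ : Fin 4), ‖covLap (((F.L : ℝ) ^ k)⁻¹) U₀ (fun z => A z κ) x‖ ≤ B * (α₀ + α₁))))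
    (h07 : ∀ F : T4Family, ∃ (ζ : ResidZ F N) (B₀ : ℝ), B11Leaf (Z11OfRecord F N ζ) ∧ Thm1AtTransfer04toSlot F N ζ B₀) :
    WitnessDialN16Free N β := by
  obtain ⟨C, hR, -⟩ := exists_slotKey_lipGauge_of_b11Leaf_transferSlot h07
  exact witnessDialN16Free_of_entry_reg910Slot hβ1 hE (G := fun _ => lipGauge 4 (Fin N)) (fun _ => radiiMono_lipGauge')
    (fun _ U x K α₀ α₁ α₂ hK hGU => interface_lipGauge' U x K α₀ α₁ α₂ hK hGU) C hR

/-- **★ THE PER-FAMILY FACE (the N19′ ∕ N21 lanes' N16 row) FROM THE NEIGHBOUR NODES' OBJECTS OF RECORD** (`0 ≤ β ≤ 1`): letters `ℓ₃ g B` with THE END's rows `N16LettersEnd N g ℓ₃`,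
the radius MATCH row, and node N16's β-root `N16HolderAt · β` AT RR-1's loose constant layer of record read by `ℓ₃ F` with data cut at `(ℓ₃ F).ε ∕ B F`, for EVERY family —
module 62 §3's `exists_letters_n16HolderAt_looseLayer_of_n05UniformP_reg910Slot` at the record-slot key.
[cite: Balaban1985RegularSpaces, Thm 4 p.88, Prop. 3 p.87] [cite: Balaban1985Variational, Thm 1 (8)–(10) p.279] [folklore] -/
theorem exists_letters_n16HolderAt_looseLayer_of_n05UniformP_b11Leaf_transferSlot (hβ0 : 0 ≤ β) (hβ1 : β ≤ 1)
    (hN05 : ∀ F : T4Family, letI : CStarAlgebra (Matrix (Fin N) (Fin N) ℂ) := B10Eq29TubeLine.cstarAlgebraMatrix N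
      ∃ (Mκ Rκ : ℕ) (len : Site 4 → ℝ), (∀ v : Site 4, 0 < len v → 1 ≤ len v) ∧ (∀ μ : Fin 4, len (e μ) = 1) ∧
      ∃ (inp : B8.B9Inputs) (B₀β B₈ c₄ c₃ : ℝ), inp.B₀ ≤ B₈ ∧ 0 < c₄ ∧ 0 < c₃ ∧
        ∀ (ν : {k : ℕ // 1 ≤ k}) (a : IdxB8SubDPerκ (stage3OfFamilyMat F N) (ne3NperOfRecord₁₁ F 0 0 * F.L ^ ν.1) Mκ Rκ),
          B8.Thm4Body c₄ (5 * ((4 : ℕ) : ℝ) * F.L * B₈)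
            (fun _ : Unit => (zdGF3HP₂Per (Matrix (Fin N) (Fin N) ℂ) F.L β len a.toZdIdx (ne3NperOfRecord₁₁ F 0 0 * F.L ^ ν.1)).toGFData) ∧
          B8.Prop3Body c₃ 4 (F.L : ℝ) (2097152 * (((4 : ℕ) : ℝ) + 1) ^ 2 * (F.L : ℝ) ^ 2) inp B₀β
            (fun _ : Unit => (zdGF3HP₂Per (Matrix (Fin N) (Fin N) ℂ) F.L β len a.toZdIdx (ne3NperOfRecord₁₁ F 0 0 * F.L ^ ν.1)).toGFData2))
    (h07 : ∀ F : T4Family, ∃ (ζ : ResidZ F N) (B₀ : ℝ), B11Leaf (Z11OfRecord F N ζ) ∧ Thm1AtTransfer04toSlot F N ζ B₀) :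
    ∃ (ℓ₃ : T4Family → NE3Letters₁₁) (g B : T4Family → ℝ), N16LettersEnd N g ℓ₃ ∧ (∀ F : T4Family, 0 < B F ∧ (ℓ₃ F).ε / B F ≤ (ℓ₃ F).b) ∧
      ∀ F : T4Family, N16HolderAt (ne3OfRecord₁₁ F { ne3ConstLayerOfRecord₁₁ F N (ℓ₃ F) with
      dom := {V | V ∈ ne3DomOfRecord₁₁ F N 0 0 ∧ V ∈ sfClass 4 F.L (ne3NperOfRecord₁₁ F 0 0) ((ℓ₃ F).ε / B F) 0} }) β := by
  obtain ⟨C, hR, -⟩ := exists_slotKey_lipGauge_of_b11Leaf_transferSlot h07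
  exact exists_letters_n16HolderAt_looseLayer_of_n05UniformP_reg910Slot hβ0 hβ1 hN05 (G := fun _ => lipGauge 4 (Fin N)) (fun _ => radiiMono_lipGauge')
    (fun _ U x K α₀ α₁ α₂ hK hGU => interface_lipGauge' U x K α₀ α₁ α₂ hK hGU) C hR

/-! ## §3 ★★ Node N16's guard-generic stub-1 face at the Ax reading, from the neighbour nodes' objects of record -/

/-- **★★ NODE N16's STUB-1 SHARE AT THE Ax READING, GUARD-GENERIC, FROM NODE N05's Σ-OBJECT, NODE N07's SLOT OF RECORD AND THE TRANSFER** (`0 ≤ β ≤ 1`): for ANY predicate `Gd`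
on Ax readings closed under re-pinning the NE3 layer and ANY reading `𝔯` with `Gd 𝔯` — a reading `𝔯'` (:= `repinAx 𝔯 ℓ₃ B`) and a dial `(ℓ₃, g, B)` with `Gd 𝔯'`, the pin
`N16PinnedLooseAx 𝔯' ℓ₃ B`, THE END's rows, the MATCH row, and node N16's conjunct of the rates row `N16HolderAt (rateCarriersOfRecord₁₃CoPHCmap 𝔯' F θ hP g₀ os k).ne3 β` at
EVERY tuple and run length (module 63 §3 ∘ §2). [cite: Balaban1985RegularSpaces, Thm 4 p.88, Prop. 3 p.87] [cite: Balaban1985Variational, Thm 1 (8)–(10) p.279] [folklore] -/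
theorem exists_guarded_pin_n16HolderAt_rateCarriersAx_of_n05UniformP_b11Leaf_transferSlot (hβ0 : 0 ≤ β) (hβ1 : β ≤ 1)
    (hN05 : ∀ F : T4Family, letI : CStarAlgebra (Matrix (Fin N) (Fin N) ℂ) := B10Eq29TubeLine.cstarAlgebraMatrix N
      ∃ (Mκ Rκ : ℕ) (len : Site 4 → ℝ), (∀ v : Site 4, 0 < len v → 1 ≤ len v) ∧ (∀ μ : Fin 4, len (e μ) = 1) ∧
      ∃ (inp : B8.B9Inputs) (B₀β B₈ c₄ c₃ : ℝ), inp.B₀ ≤ B₈ ∧ 0 < c₄ ∧ 0 < c₃ ∧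
        ∀ (ν : {k : ℕ // 1 ≤ k}) (a : IdxB8SubDPerκ (stage3OfFamilyMat F N) (ne3NperOfRecord₁₁ F 0 0 * F.L ^ ν.1) Mκ Rκ),
          B8.Thm4Body c₄ (5 * ((4 : ℕ) : ℝ) * F.L * B₈)
            (fun _ : Unit => (zdGF3HP₂Per (Matrix (Fin N) (Fin N) ℂ) F.L β len a.toZdIdx (ne3NperOfRecord₁₁ F 0 0 * F.L ^ ν.1)).toGFData) ∧
          B8.Prop3Body c₃ 4 (F.L : ℝ) (2097152 * (((4 : ℕ) : ℝ) + 1) ^ 2 * (F.L : ℝ) ^ 2) inp B₀β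
            (fun _ : Unit => (zdGF3HP₂Per (Matrix (Fin N) (Fin N) ℂ) F.L β len a.toZdIdx (ne3NperOfRecord₁₁ F 0 0 * F.L ^ ν.1)).toGFData2))
    (h07 : ∀ F : T4Family, ∃ (ζ : ResidZ F N) (B₀ : ℝ), B11Leaf (Z11OfRecord F N ζ) ∧ Thm1AtTransfer04toSlot F N ζ B₀)
    {Gd : RateReading₁₃CoPHAx N → Prop} (hGd : ∀ (𝔯 : RateReading₁₃CoPHAx N) (ℓ₃ : T4Family → NE3Letters₁₁) (B : T4Family → ℝ), Gd 𝔯 → Gd (repinAx 𝔯 ℓ₃ B))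
    {𝔯 : RateReading₁₃CoPHAx N} (h𝔯 : Gd 𝔯) :
    ∃ (𝔯' : RateReading₁₃CoPHAx N) (ℓ₃ : T4Family → NE3Letters₁₁) (g B : T4Family → ℝ), Gd 𝔯' ∧ N16PinnedLooseAx 𝔯' ℓ₃ B ∧ N16LettersEnd N g ℓ₃ ∧
      (∀ F : T4Family, 0 < B F ∧ (ℓ₃ F).ε / B F ≤ (ℓ₃ F).b) ∧
      ∀ (F : T4Family) (θ : Stage13HParams F N) (hP : θ.Provisos₁₃CoPHAx F N) (g₀ : ℕ → ℝ) (os : List (ULoop F)) (k : ℕ),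
        N16HolderAt (rateCarriersOfRecord₁₃CoPHCmap 𝔯' F θ hP g₀ os k).ne3 β :=
  exists_guarded_pin_n16HolderAt_rateCarriersAx_of_witnessFree hGd (witnessDialN16Free_of_n05UniformP_b11Leaf_transferSlot hβ0 hβ1 hN05 h07) h𝔯

/-! ## §4 ★★ The registered K3ᴬ v8 stub-1 text with node N16 paid from the neighbour nodes' objects of record (`N = 2`) -/

/-- **★★ THE STUB-1 BILL WITH NODE N16 PAID FROM NODE N05's Σ-OBJECT, NODE N07's SLOT OF RECORD AND THE TRANSFER** (`N = 2`; `0 ≤ β ≤ 1` from the window): the REGISTERED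
stub-1 TEXT of K3ᴬ v8 (`K3Skeleton13SepCoPHAxV8.stub_rates13HV`, b38fad1764a2d455; = `K3AxV8StubTexts.Stub1TextV8` by `Iff.rfl`) from (i) `β` in print's window, (ii) ONE
v4-guarded reading `GuardedReading 𝔯 ksel ℓ` (the N14 ∕ N15 ∕ node-U3 pins + keyed N15 liveness — the other lanes' objects), (iii) the K4 face `KeyedRatesHolderD4V β` at the
NE3-ERASED reading `eraseNE3Ax 𝔯` (every rates-row conjunct EXCEPT node N16's — the other lanes' content), (iv) node N05's Σ-text, (v) node N07's slot of record ∧ the located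
transfer — module 65 §4's `stub1Text_of_witnessFree` ∘ §2.  NOT a proof of the stub: (ii)–(v) are displayed.
[cite: Balaban1985RegularSpaces, Thm 4 p.88, Prop. 3 p.87] [cite: Balaban1985Variational, Thm 1 (8)–(10) p.279] [folklore] -/
theorem stub1Text_of_n05UniformP_b11Leaf_transferSlot (hβ : 2 / 3 < β ∧ β < 1)
    (hN05 : ∀ F : T4Family, letI : CStarAlgebra (Matrix (Fin 2) (Fin 2) ℂ) := B10Eq29TubeLine.cstarAlgebraMatrix 2
      ∃ (Mκ Rκ : ℕ) (len : Site 4 → ℝ), (∀ v : Site 4, 0 < len v → 1 ≤ len v) ∧ (∀ μ : Fin 4, len (e μ) = 1) ∧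
      ∃ (inp : B8.B9Inputs) (B₀β B₈ c₄ c₃ : ℝ), inp.B₀ ≤ B₈ ∧ 0 < c₄ ∧ 0 < c₃ ∧
        ∀ (ν : {k : ℕ // 1 ≤ k}) (a : IdxB8SubDPerκ (stage3OfFamilyMat F 2) (ne3NperOfRecord₁₁ F 0 0 * F.L ^ ν.1) Mκ Rκ),
          B8.Thm4Body c₄ (5 * ((4 : ℕ) : ℝ) * F.L * B₈)
            (fun _ : Unit => (zdGF3HP₂Per (Matrix (Fin 2) (Fin 2) ℂ) F.L β len a.toZdIdx (ne3NperOfRecord₁₁ F 0 0 * F.L ^ ν.1)).toGFData) ∧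
          B8.Prop3Body c₃ 4 (F.L : ℝ) (2097152 * (((4 : ℕ) : ℝ) + 1) ^ 2 * (F.L : ℝ) ^ 2) inp B₀β
            (fun _ : Unit => (zdGF3HP₂Per (Matrix (Fin 2) (Fin 2) ℂ) F.L β len a.toZdIdx (ne3NperOfRecord₁₁ F 0 0 * F.L ^ ν.1)).toGFData2))
    (h07 : ∀ F : T4Family, ∃ (ζ : ResidZ F 2) (B₀ : ℝ), B11Leaf (Z11OfRecord F 2 ζ) ∧ Thm1AtTransfer04toSlot F 2 ζ B₀)
    {𝔯 : RateReading13AxP} {ksel : RunSel} {ℓ : LetterReading} (hGd : GuardedReading 𝔯 ksel ℓ) (hK : KeyedRatesHolderD4V β (rrOfRecord (eraseNE3Ax 𝔯) ksel)) :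
    ∃ β : ℝ, 2 / 3 < β ∧ β < 1 ∧
      ∃ (𝔯 : RateReading13AxP) (ksel : RunSel) (ℓ : LetterReading) (ℓ₃ : T4Family → Node00.NE3Letters₁₁) (g B : T4Family → ℝ),
        GuardedReadingN16 𝔯 ksel ℓ ℓ₃ g B ∧ KeyedRatesHolderD4V β (rrOfRecord 𝔯 ksel) :=
  stub1Text_of_witnessFree hβ
    (witnessDialN16Free_of_n05UniformP_b11Leaf_transferSlot (le_trans (by norm_num) hβ.1.le) hβ.2.le hN05 h07) hGd hK

end

end Summit.QuantumFields.YangMills.BalabanUVNodes.N16WitnessDialOfRecordEdges
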